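import Mathlib
import Summits.NavierStokesRegularity.NavierStokesRegularity.Theorems.TaoLadderRungTwoBreakBlowupRigidityOneDatumScaling
import Summits.NavierStokesRegularity.NavierStokesRegularity.Theorems.TaoLadderRungTwoBreakBlowupRigidityOneRobustBudget
import HarnessLib

/-!
# Pseudo-solutions scale: datum `× c`, budgets `× c` — the critical robustness budget of a one-shell datum is
  1-homogeneous, and the ceiling of `robustBudget_le` becomes the HOMOGENEOUS bound `κ ≤ 16√2 m² (1+ε₀)^{16} ‖X₀‖`
  (numbers for the hypothesis of K2(1) `TaoLadderRungTwoBreak.BlowupRigidityOne`, stmt-NavierStokesRegularity-20206)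

MODEL lattice ODEs only (Tao 2016 §4 Lemma 4.1 (4.5)–(4.11), Thm. 4.2 statement shape); nothing here is a statement
about the Navier–Stokes equations; NO item is closed (`--supports stmt-NavierStokesRegularity-20206`). General `m`; DEF-FREE.

* `hasGlobal_budget_datum_scale` — `HasGlobal ε₀ α K₁ K₂ 0 X₀ → HasGlobal ε₀ α (cK₁) (cK₂) 0 (c·X₀)` (`c > 0`): the
  tree's table scaling (`cascadeFrom_tableScale`, time change, budgets `× c`) composed with the amplitude scaling
  `cascadeFrom_ampScale` (…DatumScaling, budgets fixed). So the set of budgets WITHOUT a global pseudo-solution scales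
  linearly with the datum: the critical budget `κ₀(α, X₀)` is 1-homogeneous in `X₀` (and robustness itself, its
  positivity, is 0-homogeneous: `noGlobalCascade_datumScale_iff`).
* `robustBudget_le_homogeneous` — for `α ∈ E₂(R)` every budget `κ` with `¬ HasGlobal ε₀ α κ κ 0 X₀` obeys
  `κ ≤ 16√2 m² (1+ε₀)^{16} ‖X₀‖` (the ceiling `8√2 m² (1+ε₀)^{16}(2‖cX₀‖+1)/c` of `robustBudget_le` at the rescaled
  datum, optimised over `c → ∞`); `m = 4`: `κ ≤ 256√2 (1+ε₀)^{16}‖X₀‖`.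

HONEST LABEL: symmetry bookkeeping + a number; no stub, crux or summit is proved; rung 0.
-/

noncomputable section

-- the summit and its single sub-problem share the name (CONVENTIONS §1)
set_option linter.dupNamespace false

open Set Filter Topology

namespace Summit.NavierStokesRegularity.NavierStokesRegularity.Theorems

namespace BlowupRigidityOne

open Literature.Analysis.FluidPDE Literature.Analysis.FluidPDE.TaoCascade
open Summit.NavierStokesRegularity.NavierStokesRegularity.Theorems.RungThreeTaoMechanism

variable {m : ℕ}

/-- **Pseudo-solutions scale: datum `× c`, budgets `× c`.** For `ε₀ > 0` and `c > 0`,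
`HasGlobal ε₀ α K₁ K₂ 0 X₀ → HasGlobal ε₀ α (c K₁) (c K₂) 0 (c·X₀)`.
[cite: Tao2016AveragedNS, §4 Lemma 4.1 (4.5)–(4.11); cell vocabulary (`HasGlobal`)] -/
theorem hasGlobal_budget_datum_scale {ε₀ : ℝ} (hε : 0 < ε₀)
    {α : Fin m → Fin m → Fin m → ℤ × ℤ × ℤ → ℝ} {K₁ K₂ c : ℝ} (hc : 0 < c) {X₀ : Fin m → ℝ}
    (h : HasGlobal ε₀ α K₁ K₂ 0 X₀) : HasGlobal ε₀ α (c * K₁) (c * K₂) 0 (fun i => c * X₀ i) := by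
  -- table scaling with the scalar `c⁻¹`: an `α = c⁻¹·(c·α)`-solution with `(K₁,K₂)` is a `(c·α)`-solution with `(cK₁, cK₂)`
  obtain ⟨X, E, hXE⟩ := h
  have hα : (fun a b d μ => c⁻¹ * ((fun a b d μ => c * α a b d μ) a b d μ)) = α := by
    funext a b d μ
    rw [← mul_assoc, inv_mul_cancel₀ hc.ne', one_mul]
  have hXE' : CascadeODESolutionFrom ε₀ (fun a b d μ => c⁻¹ * ((fun a b d μ => c * α a b d μ) a b d μ))
      K₁ K₂ 0 X₀ X E := by rw [hα]; exact hXE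
  have h1 := cascadeFrom_tableScale hε (inv_pos.2 hc) hXE'
  rw [inv_inv] at h1
  have hG : HasGlobal ε₀ (fun a b d μ => c * α a b d μ) (K₁ * c) (K₂ * c) 0 X₀ := ⟨_, _, h1⟩
  -- amplitude scaling back to the table `α` with the datum `c·X₀`
  have h2 := hasGlobal_ampScale hε hc hG
  rwa [mul_comm K₁ c, mul_comm K₂ c] at h2

/-- **HOMOGENEOUS CEILING ON THE ROBUSTNESS BUDGET.** For `ε₀ > 0`, `α ∈ E₂(R)` and a one-shell datum `X₀`, every budget
`κ` without a global `(κ,κ)`-pseudo-solution from shell `0` satisfies `κ ≤ 16√2 m² (1+ε₀)^{16} ‖X₀‖`.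
[cite: Tao2016AveragedNS, §4 Thm. 4.2 (statement shape), Lemma 4.1; cell vocabulary (`NoGlobalCascade`, `HasGlobal`)] -/
theorem robustBudget_le_homogeneous {ε₀ R κ : ℝ} (hε : 0 < ε₀)
    {α : Fin m → Fin m → Fin m → ℤ × ℤ × ℤ → ℝ} (hα : InTableClass R α) {X₀ : Fin m → ℝ}
    (hno : ¬ HasGlobal ε₀ α κ κ 0 X₀) :
    κ ≤ 16 * Real.sqrt 2 * (m : ℝ) ^ 2 * (1 + ε₀) ^ (16 : ℝ) * ‖X₀‖ := by
  set C : ℝ := 8 * Real.sqrt 2 * (m : ℝ) ^ 2 * (1 + ε₀) ^ (16 : ℝ) with hC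
  have hC0 : 0 ≤ C := by positivity
  -- for every `c > 0`: no global pseudo-solution at budget `cκ` from `c·X₀`, hence `cκ ≤ C (2‖cX₀‖ + 1)`
  have key : ∀ c : ℝ, 0 < c → κ ≤ C * (2 * ‖X₀‖) + C / c := by
    intro c hc
    have hno' : ¬ HasGlobal ε₀ α (c * κ) (c * κ) 0 (fun i => c * X₀ i) := by
      intro hG
      have h := hasGlobal_budget_datum_scale hε (inv_pos.2 hc) hG
      have hX : (fun i => c⁻¹ * ((fun i => c * X₀ i) i)) = X₀ := by
        funext i; rw [← mul_assoc, inv_mul_cancel₀ hc.ne', one_mul]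
      rw [hX, ← mul_assoc, inv_mul_cancel₀ hc.ne', one_mul] at h
      exact hno h
    have hle := robustBudget_le hε hα hno'
    have hnorm : ‖(fun i => c * X₀ i)‖ = c * ‖X₀‖ := by
      have : (fun i => c * X₀ i) = c • X₀ := by funext i; simp [Pi.smul_apply, smul_eq_mul]
      rw [this, norm_smul, Real.norm_eq_abs, abs_of_pos hc]
    rw [hnorm] at hle
    -- `c κ ≤ C (2 c ‖X₀‖ + 1)` ⇒ divide by `c`
    have h1 : c * κ ≤ c * (C * (2 * ‖X₀‖) + C / c) := by
      have : c * (C * (2 * ‖X₀‖) + C / c) = C * (2 * (c * ‖X₀‖) + 1) := by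
        field_simp
      rw [this]
      calc c * κ ≤ 8 * Real.sqrt 2 * (m : ℝ) ^ 2 * (1 + ε₀) ^ (16 : ℝ) * (2 * (c * ‖X₀‖) + 1) := hle
        _ = C * (2 * (c * ‖X₀‖) + 1) := by rw [hC]
    exact le_of_mul_le_mul_left h1 hc
  -- let `c → ∞`
  by_contra hcon
  push Not at hcon
  have hgap : 0 < κ - C * (2 * ‖X₀‖) := by
    have : C * (2 * ‖X₀‖) = 16 * Real.sqrt 2 * (m : ℝ) ^ 2 * (1 + ε₀) ^ (16 : ℝ) * ‖X₀‖ := by rw [hC]; ring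
    linarith
  -- choose `c` with `C / c < κ - 2C‖X₀‖`
  obtain ⟨c, hc, hcC⟩ : ∃ c : ℝ, 0 < c ∧ C / c < κ - C * (2 * ‖X₀‖) := by
    refine ⟨(C + 1) / (κ - C * (2 * ‖X₀‖)), div_pos (by linarith) hgap, ?_⟩
    rw [div_lt_iff₀ (div_pos (by linarith) hgap), mul_div_assoc', lt_div_iff₀ hgap]
    nlinarith [hgap]
  have := key c hc
  linarith

end BlowupRigidityOne

end Summit.NavierStokesRegularity.NavierStokesRegularity.Theorems

end
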